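import Summits.QuantumFields.BalabanUV.Beta.CompositeMixedTableBounds
import Summits.QuantumFields.BalabanUV.Beta.CompositeMixedTableGradedCov
import Summits.QuantumFields.BalabanUV.Beta.CombMixedT2EvenGradedLetters

/-!
# `BalabanUV.Beta.CompositeMixedTableGradedBounds` — row D1 ∕ (C1) OWNER «beta-an2», PART 91, v11 (T1): **THE BOUND AND (Lmix) OF THE GRADED COMPOSITE MIXED TABLE** — F6c part 2
# (`CompositeMixedTableBounds`) for (F0)'s `compMixKerG ∕ compMixFFG ∕ compMixG`: `|compMixKerG m| ≤ bndMix m` by the same induction (the graded recursion is F6c's with the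
# third cross word's SIGN flipped — the five-summand triangle inequality does not see the sign), `LocStencilFM (L^m) (compMixFFG … m) (bndMix m · e^{3(d+1)·wid m·δ}) δ` via F6c's
# window-generic lemma and (F0)∕78a∕79a's support letters, and the literal-level instance `compMixG r L m` with an1's brick constants: **`compMixG_hmix`** — the `hmix`
# certificate the graded table record `tabsRecG := { tabsComp … with mixFF := compMixG … }` needs (FINDING AN2-82-2: under (T1) the door's defect kernel reads the END's ONE
# mixed table `hM₂′`; (Tmix) is 79a `compMixG_translate`)  (β-function cell `pub-balaban`, BINDER-OWNERS row D1)

[folklore] finite sums ∕ one induction over OUR typed objects + F6c's `bndMix ∕ locStencilFM_packFF_of_window` + F3b's `abs_compLinKer_le ∕ abs_compVHKer_le` + an1's brick bounds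
BY NAME; no `def`, no `def … : Prop`, nothing cited, 0 sorry.  Nothing of Bałaban's asserted, valued or discharged; 0 estimates; 0∕4 row-D1 binders; NOT (C1), NOT D1,
NEVER «G-an2-4 closed», NOT BetaPertH, NOT continuum, NOT Clay.

HONEST DEPENDENCY (page 1, mandatory): continuum YM on T⁴ ⇐ BetaPertH ∧ nine spine estimates (0/9 proved); BetaPertH ⇐ (D1) ∧
(D4) ∧ CAP+tail; G-an2-4 gates asym, D1 and NE2/3/4.  Row D1 ∕ (C1) OWNER «beta-an2», b2b-balaban-beta-an2 gen 82, 2026-08-29.  No existing file touched.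
-/

noncomputable section

open scoped BigOperators

namespace Summit.QuantumFields.BalabanUV.Beta.CompositeMixedTableGradedBounds

open Finset
open Literature.MathematicalPhysics.QuantumFieldTheory.Balaban1983to89
open Literature.MathematicalPhysics.QuantumFieldTheory.Balaban1983to89.Beta
open AffineAveraging (Site)
open AveragingHessianKernels (Bond)
open Summit.QuantumFields.BalabanUV.Beta.CompositeVertexKernelRec (offs card_offs compLinKer compVHKer bndVH bndVH_nonneg abs_compLinKer_le abs_compVHKer_le)
open Summit.QuantumFields.BalabanUV.Beta.CompositeMixedTable (bndMix bndMix_nonneg abs_add_five locStencilFM_packFF_of_window)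
open Summit.QuantumFields.BalabanUV.Beta.CompositeMixedTableGraded (compMixKerG compMixFFG compMixG compMixKerG_zero compMixKerG_succ)
open Summit.QuantumFields.BalabanUV.Beta.CompositeMixedTableGradedCov (compMixKerG_eq_zero_left compMixKerG_eq_zero_right)
open Summit.QuantumFields.BalabanUV.Beta.CombMixedT2EvenGradedLetters (compMixKerG_eq_zero_bg)

variable {d : ℕ}
variable {ℓ : ℕ → Fin (d + 1) → Site (d + 1) → Bond (d + 1) → ℝ}
  {𝓋 𝒽 : ℕ → Fin (d + 1) → Site (d + 1) → Bond (d + 1) → Bond (d + 1) → ℝ}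
  {𝓉 : ℕ → Fin (d + 1) → Site (d + 1) → Bond (d + 1) → Bond (d + 1) → Bond (d + 1) → ℝ} {L : ℕ}

/-! ## §1 Bound by induction (F6c's `bndMix`) -/

/-- [folklore] the triangle inequality for five summands, the third subtracted. -/
theorem abs_add_sub_five (a b c e g : ℝ) : |a + b - c + e + g| ≤ |a| + |b| + |c| + |e| + |g| := by
  have h := abs_add_five a b (-c) e g
  rw [abs_neg] at h
  simpa [sub_eq_add_neg] using h

/-- [folklore] BOUND ON THE GRADED COMPOSITE MIXED KERNEL: `|compMixKerG m| ≤ bndMix m` (F6c's proof; the flipped sign is absorbed by `abs_add_sub_five`). -/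
theorem abs_compMixKerG_le {Bℓ B𝓋 B𝒽 B𝓉 : ℝ} (hB : 0 ≤ Bℓ) (hB' : 0 ≤ B𝓋) (hB'' : 0 ≤ B𝒽) (hB''' : 0 ≤ B𝓉)
    (hℓb : ∀ m μ y f, |ℓ m μ y f| ≤ Bℓ) (h𝓋b : ∀ m μ y f f', |𝓋 m μ y f f'| ≤ B𝓋) (h𝒽b : ∀ m μ y f f', |𝒽 m μ y f f'| ≤ B𝒽)
    (h𝓉b : ∀ m μ y g f f', |𝓉 m μ y g f f'| ≤ B𝓉) :
    ∀ (m : ℕ) (μ : Fin (d + 1)) (y : Site (d + 1)) (g f f' : Bond (d + 1)),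
      |compMixKerG ℓ 𝓋 𝒽 𝓉 L m μ y g f f'| ≤ bndMix d L Bℓ B𝓋 B𝒽 B𝓉 m
  | 0, _, _, _, _, _ => by rw [compMixKerG_zero, abs_zero]; exact le_rfl
  | m + 1, μ, y, g, f, f' => by
      rw [compMixKerG_succ]
      set D := ((d : ℝ) + 1) * (2 * (L : ℝ)) ^ (d + 1) with hD
      set C := ((d : ℝ) + 1) * (2 * (L : ℝ)) ^ (d + 1) * Bℓ with hC
      have hCm : 0 ≤ C ^ m := pow_nonneg (by positivity) m
      have hIH := abs_compMixKerG_le hB hB' hB'' hB''' hℓb h𝓋b h𝒽b h𝓉b m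
      have hbM := bndMix_nonneg (d := d) (L := L) hB hB' hB'' hB''' m
      have hb1 := bndVH_nonneg (d := d) (L := L) hB hB' m
      have hb2 := bndVH_nonneg (d := d) (L := L) hB hB'' m
      have hKv := abs_compVHKer_le (ℓ := ℓ) (𝓋 := 𝓋) (L := L) hB hB' hℓb h𝓋b m
      have hKh := abs_compVHKer_le (ℓ := ℓ) (𝓋 := 𝒽) (L := L) hB hB'' hℓb h𝒽b m
      have hL1 := abs_compLinKer_le (ℓ := ℓ) (L := L) hB hℓb m
      have S1 : |∑ κ : Fin (d + 1), ∑ e ∈ offs L, ∑ κ₁ : Fin (d + 1), ∑ e₁ ∈ offs L, ∑ κ₂ : Fin (d + 1), ∑ e₂ ∈ offs L,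
          𝓉 m μ y (κ, (L : ℤ) • y + e) (κ₁, (L : ℤ) • y + e₁) (κ₂, (L : ℤ) • y + e₂)
            * compLinKer ℓ L m g (κ, (L : ℤ) • y + e) * compLinKer ℓ L m f (κ₁, (L : ℤ) • y + e₁)
            * compLinKer ℓ L m f' (κ₂, (L : ℤ) • y + e₂)|
          ≤ D ^ 3 * B𝓉 * (C ^ m) ^ 3 := by
        calc _ ≤ ∑ κ : Fin (d + 1), ∑ e ∈ offs L, ∑ κ₁ : Fin (d + 1), ∑ e₁ ∈ offs L, ∑ κ₂ : Fin (d + 1), ∑ e₂ ∈ offs L,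
                B𝓉 * C ^ m * C ^ m * C ^ m := by
              refine (Finset.abs_sum_le_sum_abs _ _).trans (Finset.sum_le_sum fun κ _ => ?_)
              refine (Finset.abs_sum_le_sum_abs _ _).trans (Finset.sum_le_sum fun e _ => ?_)
              refine (Finset.abs_sum_le_sum_abs _ _).trans (Finset.sum_le_sum fun κ₁ _ => ?_)
              refine (Finset.abs_sum_le_sum_abs _ _).trans (Finset.sum_le_sum fun e₁ _ => ?_)
              refine (Finset.abs_sum_le_sum_abs _ _).trans (Finset.sum_le_sum fun κ₂ _ => ?_)
              refine (Finset.abs_sum_le_sum_abs _ _).trans (Finset.sum_le_sum fun e₂ _ => ?_)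
              rw [abs_mul, abs_mul, abs_mul]
              exact mul_le_mul (mul_le_mul (mul_le_mul (h𝓉b _ _ _ _ _ _) (hL1 _ _) (abs_nonneg _) hB''') (hL1 _ _)
                (abs_nonneg _) (mul_nonneg hB''' hCm)) (hL1 _ _) (abs_nonneg _) (mul_nonneg (mul_nonneg hB''' hCm) hCm)
          _ = D ^ 3 * B𝓉 * (C ^ m) ^ 3 := by
              simp only [Finset.sum_const, Finset.card_univ, Fintype.card_fin, nsmul_eq_mul, card_offs]
              rw [hD]; push_cast; ring
      have S2 : |∑ κ₁ : Fin (d + 1), ∑ e₁ ∈ offs L, ∑ κ₂ : Fin (d + 1), ∑ e₂ ∈ offs L,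
          𝒽 m μ y (κ₁, (L : ℤ) • y + e₁) (κ₂, (L : ℤ) • y + e₂)
            * compVHKer ℓ 𝓋 L m κ₁ ((L : ℤ) • y + e₁) f g * compLinKer ℓ L m f' (κ₂, (L : ℤ) • y + e₂)|
          ≤ D ^ 2 * B𝒽 * bndVH d L Bℓ B𝓋 m * C ^ m := by
        calc _ ≤ ∑ κ₁ : Fin (d + 1), ∑ e₁ ∈ offs L, ∑ κ₂ : Fin (d + 1), ∑ e₂ ∈ offs L, B𝒽 * bndVH d L Bℓ B𝓋 m * C ^ m := by
              refine (Finset.abs_sum_le_sum_abs _ _).trans (Finset.sum_le_sum fun κ₁ _ => ?_)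
              refine (Finset.abs_sum_le_sum_abs _ _).trans (Finset.sum_le_sum fun e₁ _ => ?_)
              refine (Finset.abs_sum_le_sum_abs _ _).trans (Finset.sum_le_sum fun κ₂ _ => ?_)
              refine (Finset.abs_sum_le_sum_abs _ _).trans (Finset.sum_le_sum fun e₂ _ => ?_)
              rw [abs_mul, abs_mul]
              exact mul_le_mul (mul_le_mul (h𝒽b _ _ _ _ _) (hKv _ _ _ _) (abs_nonneg _) hB'') (hL1 _ _) (abs_nonneg _)
                (mul_nonneg hB'' hb1)
          _ = D ^ 2 * B𝒽 * bndVH d L Bℓ B𝓋 m * C ^ m := by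
              simp only [Finset.sum_const, Finset.card_univ, Fintype.card_fin, nsmul_eq_mul, card_offs]
              rw [hD]; push_cast; ring
      have S3 : |∑ κ₁ : Fin (d + 1), ∑ e₁ ∈ offs L, ∑ κ₂ : Fin (d + 1), ∑ e₂ ∈ offs L,
          𝒽 m μ y (κ₁, (L : ℤ) • y + e₁) (κ₂, (L : ℤ) • y + e₂)
            * compLinKer ℓ L m f (κ₁, (L : ℤ) • y + e₁) * compVHKer ℓ 𝓋 L m κ₂ ((L : ℤ) • y + e₂) f' g|
          ≤ D ^ 2 * B𝒽 * bndVH d L Bℓ B𝓋 m * C ^ m := by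
        calc _ ≤ ∑ κ₁ : Fin (d + 1), ∑ e₁ ∈ offs L, ∑ κ₂ : Fin (d + 1), ∑ e₂ ∈ offs L, B𝒽 * C ^ m * bndVH d L Bℓ B𝓋 m := by
              refine (Finset.abs_sum_le_sum_abs _ _).trans (Finset.sum_le_sum fun κ₁ _ => ?_)
              refine (Finset.abs_sum_le_sum_abs _ _).trans (Finset.sum_le_sum fun e₁ _ => ?_)
              refine (Finset.abs_sum_le_sum_abs _ _).trans (Finset.sum_le_sum fun κ₂ _ => ?_)
              refine (Finset.abs_sum_le_sum_abs _ _).trans (Finset.sum_le_sum fun e₂ _ => ?_)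
              rw [abs_mul, abs_mul]
              exact mul_le_mul (mul_le_mul (h𝒽b _ _ _ _ _) (hL1 _ _) (abs_nonneg _) hB'') (hKv _ _ _ _) (abs_nonneg _)
                (mul_nonneg hB'' hCm)
          _ = D ^ 2 * B𝒽 * bndVH d L Bℓ B𝓋 m * C ^ m := by
              simp only [Finset.sum_const, Finset.card_univ, Fintype.card_fin, nsmul_eq_mul, card_offs]
              rw [hD]; push_cast; ring
      have S4 : |∑ κ₁ : Fin (d + 1), ∑ e₁ ∈ offs L, ∑ κ : Fin (d + 1), ∑ e ∈ offs L,
          𝓋 m μ y (κ₁, (L : ℤ) • y + e₁) (κ, (L : ℤ) • y + e)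
            * compVHKer ℓ 𝒽 L m κ₁ ((L : ℤ) • y + e₁) f f' * compLinKer ℓ L m g (κ, (L : ℤ) • y + e)|
          ≤ D ^ 2 * B𝓋 * bndVH d L Bℓ B𝒽 m * C ^ m := by
        calc _ ≤ ∑ κ₁ : Fin (d + 1), ∑ e₁ ∈ offs L, ∑ κ : Fin (d + 1), ∑ e ∈ offs L, B𝓋 * bndVH d L Bℓ B𝒽 m * C ^ m := by
              refine (Finset.abs_sum_le_sum_abs _ _).trans (Finset.sum_le_sum fun κ₁ _ => ?_)
              refine (Finset.abs_sum_le_sum_abs _ _).trans (Finset.sum_le_sum fun e₁ _ => ?_)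
              refine (Finset.abs_sum_le_sum_abs _ _).trans (Finset.sum_le_sum fun κ _ => ?_)
              refine (Finset.abs_sum_le_sum_abs _ _).trans (Finset.sum_le_sum fun e _ => ?_)
              rw [abs_mul, abs_mul]
              exact mul_le_mul (mul_le_mul (h𝓋b _ _ _ _ _) (hKh _ _ _ _) (abs_nonneg _) hB') (hL1 _ _) (abs_nonneg _)
                (mul_nonneg hB' hb2)
          _ = D ^ 2 * B𝓋 * bndVH d L Bℓ B𝒽 m * C ^ m := by
              simp only [Finset.sum_const, Finset.card_univ, Fintype.card_fin, nsmul_eq_mul, card_offs]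
              rw [hD]; push_cast; ring
      have S5 : |∑ κ : Fin (d + 1), ∑ e ∈ offs L, ℓ m μ y (κ, (L : ℤ) • y + e) * compMixKerG ℓ 𝓋 𝒽 𝓉 L m κ ((L : ℤ) • y + e) g f f'|
          ≤ D * Bℓ * bndMix d L Bℓ B𝓋 B𝒽 B𝓉 m := by
        calc _ ≤ ∑ κ : Fin (d + 1), ∑ e ∈ offs L, Bℓ * bndMix d L Bℓ B𝓋 B𝒽 B𝓉 m := by
              refine (Finset.abs_sum_le_sum_abs _ _).trans (Finset.sum_le_sum fun κ _ => ?_)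
              refine (Finset.abs_sum_le_sum_abs _ _).trans (Finset.sum_le_sum fun e _ => ?_)
              rw [abs_mul]
              exact mul_le_mul (hℓb _ _ _ _) (hIH _ _ _ _ _) (abs_nonneg _) hB
          _ = D * Bℓ * bndMix d L Bℓ B𝓋 B𝒽 B𝓉 m := by
              simp only [Finset.sum_const, Finset.card_univ, Fintype.card_fin, nsmul_eq_mul, card_offs]
              rw [hD]; push_cast; ring
      refine (abs_add_sub_five _ _ _ _ _).trans ?_
      refine (add_le_add (add_le_add (add_le_add (add_le_add S1 S2) S3) S4) S5).trans (le_of_eq ?_)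
      rw [hD, hC]; show _ = _ + _ + _ + _; ring

/-! ## §2 (Lmix): the packed graded composite mixed table is a local field–multiplier family at blocking `L^m` -/

section Loc

open ExpKernelCalculus (MKer BiLoc)
open OneStepResolventKernel (Fib)
open SecondOrderResponse (LocStencilFM)
open Summit.QuantumFields.BalabanUV.Beta.CompositeVertexKernelRec (winF wid)

/-- [folklore] **(Lmix)-SHAPE LOCALITY OF THE PACKED GRADED COMPOSITE MIXED TABLE AT EVERY RATE**: `LocStencilFM (L^m) (compMixFFG … m) (bndMix m · e^{3(d+1)·wid m·δ}) δ`
(F6c's window lemma; support letters 78a `compMixKerG_eq_zero_bg`, 79a `compMixKerG_eq_zero_left ∕ _right`; bound §1). -/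
theorem locStencilFM_compMixFFG {Bℓ B𝓋 B𝒽 B𝓉 : ℝ} (hB : 0 ≤ Bℓ) (hB' : 0 ≤ B𝓋) (hB'' : 0 ≤ B𝒽) (hB''' : 0 ≤ B𝓉)
    (hℓb : ∀ m μ y f, |ℓ m μ y f| ≤ Bℓ) (h𝓋b : ∀ m μ y f f', |𝓋 m μ y f f'| ≤ B𝓋) (h𝒽b : ∀ m μ y f f', |𝒽 m μ y f f'| ≤ B𝒽)
    (h𝓉b : ∀ m μ y g f f', |𝓉 m μ y g f f'| ≤ B𝓉) (m : ℕ) {δ : ℝ} (hδ : 0 ≤ δ) :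
    LocStencilFM (L ^ m) (compMixFFG ℓ 𝓋 𝒽 𝓉 L m) (bndMix d L Bℓ B𝓋 B𝒽 B𝓉 m * Real.exp (3 * ((d : ℝ) + 1) * (wid L m) * δ)) δ :=
  locStencilFM_packFF_of_window (fun κ u μ y f f' => compMixKerG ℓ 𝓋 𝒽 𝓉 L m μ y (κ, u) f f') (wid L m)
    (bndMix_nonneg hB hB' hB'' hB''' m) (fun _ _ _ _ f f' h => compMixKerG_eq_zero_bg m f f' h)
    (fun κ u _ _ _ f' h => compMixKerG_eq_zero_left m (κ, u) f' h) (fun κ u _ _ f _ h => compMixKerG_eq_zero_right m (κ, u) f h)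
    (fun κ u μ y f f' => abs_compMixKerG_le hB hB' hB'' hB''' hℓb h𝓋b h𝒽b h𝓉b m μ y (κ, u) f f') hδ

/-- [folklore] **(Lmix) in the record's letter shape** (rate `1`). -/
theorem compMixFFG_hmix {Bℓ B𝓋 B𝒽 B𝓉 : ℝ} (hB : 0 ≤ Bℓ) (hB' : 0 ≤ B𝓋) (hB'' : 0 ≤ B𝒽) (hB''' : 0 ≤ B𝓉)
    (hℓb : ∀ m μ y f, |ℓ m μ y f| ≤ Bℓ) (h𝓋b : ∀ m μ y f f', |𝓋 m μ y f f'| ≤ B𝓋) (h𝒽b : ∀ m μ y f f', |𝒽 m μ y f f'| ≤ B𝒽)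
    (h𝓉b : ∀ m μ y g f f', |𝓉 m μ y g f f'| ≤ B𝓉) (m : ℕ) :
    ∃ C δ : ℝ, 0 < δ ∧ LocStencilFM (L ^ m) (compMixFFG ℓ 𝓋 𝒽 𝓉 L m) C δ :=
  ⟨_, 1, one_pos, locStencilFM_compMixFFG hB hB' hB'' hB''' hℓb h𝓋b h𝒽b h𝓉b m zero_le_one⟩

end Loc

/-! ## §3 The literal-level instance `compMixG r L m` (an1's (0.4)-symmetrised bricks at one root) -/

section Sym

open ExpKernelCalculus (MKer BiLoc)
open OneStepResolventKernel (Fib)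
open SecondOrderResponse (LocStencilFM)
open AffineAveraging (box toSite)
open AveragingHessianKernels (ell)
open Summit.QuantumFields.BalabanUV.Beta.SymAveragingHessianCounts (symLinKerAt symVhKerAt symHessKerAt)
open Summit.QuantumFields.BalabanUV.Beta.SymAveragingMixedJetTables (symMixKerAt symMixAbs symMixAbs_nonneg)
open Summit.QuantumFields.BalabanUV.Beta.CompositeVertexKernelRec (wid)

variable {r : Fin (d + 1) → ℕ}

/-- [folklore] (S) BOUND for the graded kernel at an1's bricks: `|compMixKerG (sym bricks) m| ≤ bndMix m` with the constants `ℓ`, `3ℓ²`, `2ℓ²`, `symMixAbs (toSite r) L`. -/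
theorem abs_compMixKerG_sym_le (hL : 1 ≤ L) (hr : r ∈ box (d + 1) L) (m : ℕ) (μ : Fin (d + 1)) (y : Site (d + 1)) (g f f' : Bond (d + 1)) :
    |compMixKerG (fun _ => symLinKerAt (toSite r) L) (fun _ => symVhKerAt (toSite r) L) (fun _ => symHessKerAt (toSite r) L)
        (fun _ => symMixKerAt (toSite r) L) L m μ y g f f'|
      ≤ bndMix d L (ell (d + 1) L : ℝ) (3 * (ell (d + 1) L : ℝ) ^ 2) (2 * (ell (d + 1) L : ℝ) ^ 2) (symMixAbs (toSite r) L) m :=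
  abs_compMixKerG_le (ℓ := fun _ => symLinKerAt (toSite r) L) (𝓋 := fun _ => symVhKerAt (toSite r) L)
    (𝒽 := fun _ => symHessKerAt (toSite r) L) (𝓉 := fun _ => symMixKerAt (toSite r) L)
    (by positivity) (by positivity) (by positivity) (symMixAbs_nonneg _ _)
    (fun _ μ y f => SymAveragingHessianCounts.abs_symLinKerAt_le hL μ y hr f)
    (fun _ μ y f f' => SymAveragingHessianCounts.abs_symVhKerAt_le hL μ y hr f f')
    (fun _ μ y f f' => SymAveragingHessianCounts.abs_symHessKerAt_le hL μ y hr f f')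
    (fun _ μ y g f f' => SymAveragingMixedJetTables.abs_symTTab_le hr μ y f f' g) m μ y g f f'

/-- [folklore] (S) (Lmix) for `compMixG r L m` at every rate `δ ≥ 0`. -/
theorem locStencilFM_compMixG (hL : 1 ≤ L) (hr : r ∈ box (d + 1) L) (m : ℕ) {δ : ℝ} (hδ : 0 ≤ δ) :
    LocStencilFM (L ^ m) (compMixG r L m)
      (bndMix d L (ell (d + 1) L : ℝ) (3 * (ell (d + 1) L : ℝ) ^ 2) (2 * (ell (d + 1) L : ℝ) ^ 2) (symMixAbs (toSite r) L) m
        * Real.exp (3 * ((d : ℝ) + 1) * (wid L m) * δ)) δ :=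
  locStencilFM_compMixFFG (ℓ := fun _ => symLinKerAt (toSite r) L) (𝓋 := fun _ => symVhKerAt (toSite r) L)
    (𝒽 := fun _ => symHessKerAt (toSite r) L) (𝓉 := fun _ => symMixKerAt (toSite r) L)
    (by positivity) (by positivity) (by positivity) (symMixAbs_nonneg _ _)
    (fun _ μ y f => SymAveragingHessianCounts.abs_symLinKerAt_le hL μ y hr f)
    (fun _ μ y f f' => SymAveragingHessianCounts.abs_symVhKerAt_le hL μ y hr f f')
    (fun _ μ y f f' => SymAveragingHessianCounts.abs_symHessKerAt_le hL μ y hr f f')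
    (fun _ μ y g f f' => SymAveragingMixedJetTables.abs_symTTab_le hr μ y f f' g) m hδ

/-- [folklore] (S) **`compMixG_hmix`** — (Lmix) in the record's letter shape (rate `1`): `∃ C δ, 0 < δ ∧ LocStencilFM (L^m) (compMixG r L m) C δ` — the `hmix` certificate of the
graded table record. -/
theorem compMixG_hmix (hL : 1 ≤ L) (hr : r ∈ box (d + 1) L) (m : ℕ) :
    ∃ C δ : ℝ, 0 < δ ∧ LocStencilFM (L ^ m) (compMixG r L m) C δ :=
  ⟨_, 1, one_pos, locStencilFM_compMixG hL hr m zero_le_one⟩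

end Sym

end Summit.QuantumFields.BalabanUV.Beta.CompositeMixedTableGradedBounds

end
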